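import Literature.Analysis.ODE.DuffingPeriodFunction
import HarnessLib

/-!
# Proof of Chow–Wang 1986, Corollary 2.3 (global case): `chowWang1986_cor_2_3_global_holds`

This file discharges the named fact `Literature.Analysis.ODE.chowWang1986_cor_2_3_global`
(`DuffingPeriodFunction.lean`): for smooth `g = x^{2N+1} h`, `h > 0`, with `x g''(x) > 0`
(`x ≠ 0`) and `G = ∫₀ g → +∞` at `±∞`, the half-period
`T(E) = ∫_{G < E} (2(E − G(q)))^{-1/2} dq` is strictly decreasing on `(0, ∞)`.

## The printed proof and the road taken here

S.-N. Chow, D. Wang, Časopis pěst. mat. 111 (1986) 14–25. Theorem 2.1 (pp. 15–16) proves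
`c p'(c) = ∫ₐᵇ R(x) / (g(x)² √(2(c − G(x)))) dx`, `R = g² − 2 G g'`, by differentiating the
(singular, moving-endpoint) integrals `I = ∫ₐᵇ √y`, `J = ∫ₐᵇ (y − 2c) √y` (`y = 2(c − G)`) twice
in `c`; Corollary 2.3 (p. 18) then notes `R' = −2 G g''`, `R(0) = 0`, so `x g''(x) > 0` forces
`R < 0` for `x ≠ 0`, whence `p' < 0` on `(0, c*)`.

Differentiating improper integrals with moving singular endpoints under the integral sign is
not available off the shelf in Mathlib, so we prove the SAME statement by the classical
elementary comparison argument (Opial 1961; Chicone 1987), which under the hypothesis of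
Corollary 2.3 needs no derivative of `T` at all (documented deviation from the printed proof):

* (`sublevel`) `G` is strictly decreasing on `(−∞, 0]` and strictly increasing on `[0, ∞)`,
  so `{G < E} = (a, b)` with `G(a) = G(b) = E`, and `T(E) = ∫ₐ⁰ + ∫₀ᵇ` (`integral_sublevel_eq`).
* (`superlinear`, `scaled_gap`) `x g''(x) > 0` makes `g'` strictly increasing on `[0, ∞)`,
  hence (as `g(0) = 0`) `g(λx) > λ g(x)` for `λ > 1`, `x > 0` ("`g(x)/x` increases"), hence
  `x ↦ G(λx) − λ² G(x)` is strictly increasing on `[0, ∞)`.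
* (`integral_right_lt`) for `0 < b₁ < b₂`, `λ = b₂/b₁`, the substitution `q ↦ λq` gives
  `∫₀^{b₂} dq/√(2(G b₂ − G q)) = ∫₀^{b₁} λ dq/√(2(G b₂ − G(λq)))`, and pointwise
  `λ/√(2(G b₂ − G(λq))) < 1/√(2(G b₁ − G q))` is exactly `λ²(G b₁ − G q) < G b₂ − G(λq)`.
* (`intervalIntegrable_right`) finiteness: `G` is convex on `[0, ∞)`, so
  `G b − G q ≥ (G b / b)(b − q)` and the integrand is dominated by `C (b − q)^{-1/2}`.
* The left half is the right half of the reflected potential `x ↦ G(−x)`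
  (`intervalIntegrable_left`, `integral_left_lt`).

Relation to the paper's `R`: `d/dx (√G / g) = R / (2 √G g²)`, so `R < 0` says that `√G/|g|`
decreases away from `0` (the substitution form of this comparison). The `def` is proved verbatim.

## References

* S.-N. Chow, D. Wang, *On the monotonicity of the period function of some second order
  equations*, Časopis pěst. mat. 111 (1986) 14–25, Thm. 2.1, Cor. 2.3.
  [cite: ChowWang1986, Cor. 2.3]
* Z. Opial, *Sur les périodes des solutions de l'équation différentielle `x'' + g(x) = 0`*,
  Ann. Polon. Math. 10 (1961) 49–72.
* C. Chicone, *The monotonicity of the period function for planar Hamiltonian vector fields*,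
  J. Differential Equations 69 (1987) 310–321.
-/

noncomputable section

open MeasureTheory Set Filter intervalIntegral

namespace Literature.Analysis.ODE

namespace ChowWang1986

variable {G g g' g'' : ℝ → ℝ}

/-! ### One-variable calculus on `[0, ∞)` -/

/-- A function with a derivative everywhere is continuous. [folklore] -/
theorem continuous_of_hasDerivAt {f f' : ℝ → ℝ} (hf : ∀ x, HasDerivAt f (f' x) x) :
    Continuous f :=
  continuous_iff_continuousAt.2 fun x => (hf x).continuousAt

/-- `g'' > 0` on `(0, ∞)` makes `g'` strictly increasing on `[0, ∞)`. [folklore] -/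
theorem strictMonoOn_deriv (hg' : ∀ x, HasDerivAt g' (g'' x) x)
    (hpos'' : ∀ x, 0 < x → 0 < g'' x) : StrictMonoOn g' (Ici 0) := by
  refine strictMonoOn_of_deriv_pos (convex_Ici 0)
    (continuous_of_hasDerivAt hg').continuousOn fun x hx => ?_
  rw [(hg' x).deriv]
  exact hpos'' x (by simpa using hx)

/-- Superlinearity: if `g(0) = 0` and `g'' > 0` on `(0, ∞)` then `λ g(x) < g(λ x)` for `λ > 1`,
`x > 0` (i.e. `g(x)/x` is strictly increasing on `(0, ∞)`). [folklore] -/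
theorem superlinear (hg : ∀ x, HasDerivAt g (g' x) x) (hg' : ∀ x, HasDerivAt g' (g'' x) x)
    (hpos'' : ∀ x, 0 < x → 0 < g'' x) (hg0 : g 0 = 0) {l : ℝ} (hl : 1 < l) {x : ℝ}
    (hx : 0 < x) : l * g x < g (l * x) := by
  have hmono := strictMonoOn_deriv hg' hpos''
  have hl0 : 0 < l := one_pos.trans hl
  have hgc := continuous_of_hasDerivAt hg
  have key : StrictMonoOn (fun x => g (l * x) - l * g x) (Ici 0) := by
    refine strictMonoOn_of_deriv_pos (convex_Ici 0) (by fun_prop) fun y hy => ?_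
    rw [interior_Ici] at hy
    have h1 : HasDerivAt (fun x => g (l * x)) (g' (l * y) * l) y :=
      (hg (l * y)).comp y (hasDerivAt_const_mul l)
    rw [(h1.fun_sub ((hg y).const_mul l)).deriv]
    have hy' : y < l * y := lt_mul_of_one_lt_left hy hl
    have h2 := hmono (Set.mem_Ici.2 (le_of_lt hy)) (Set.mem_Ici.2 (hy.trans hy').le) hy'
    nlinarith
  have h3 := key (Set.mem_Ici.2 le_rfl) (Set.mem_Ici.2 hx.le) hx
  simp only [mul_zero, hg0, sub_self] at h3
  linarith

/-- For `λ > 1`, `x ↦ G(λx) − λ² G(x)` is strictly increasing on `[0, ∞)`; in particular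
`λ² (G b − G q) < G(λb) − G(λq)` for `0 ≤ q < b`. [folklore] -/
theorem scaled_gap (hG : ∀ x, HasDerivAt G (g x) x) (hg : ∀ x, HasDerivAt g (g' x) x)
    (hg' : ∀ x, HasDerivAt g' (g'' x) x) (hpos'' : ∀ x, 0 < x → 0 < g'' x) (hg0 : g 0 = 0)
    {l : ℝ} (hl : 1 < l) {q b : ℝ} (hq : 0 ≤ q) (hqb : q < b) :
    l ^ 2 * (G b - G q) < G (l * b) - G (l * q) := by
  have hl0 : 0 < l := one_pos.trans hl
  have hGc := continuous_of_hasDerivAt hG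
  have key : StrictMonoOn (fun x => G (l * x) - l ^ 2 * G x) (Ici 0) := by
    refine strictMonoOn_of_deriv_pos (convex_Ici 0) (by fun_prop) fun y hy => ?_
    rw [interior_Ici] at hy
    have h1 : HasDerivAt (fun x => G (l * x)) (g (l * y) * l) y :=
      (hG (l * y)).comp y (hasDerivAt_const_mul l)
    rw [(h1.fun_sub ((hG y).const_mul (l ^ 2))).deriv]
    have h2 := superlinear hg hg' hpos'' hg0 hl hy
    nlinarith
  have h3 := key (Set.mem_Ici.2 hq) (Set.mem_Ici.2 (hq.trans hqb.le)) hqb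
  simp only at h3
  linarith

/-- `g > 0` on `(0, ∞)` makes `G` strictly increasing on `[0, ∞)`. [folklore] -/
theorem strictMonoOn_prim (hG : ∀ x, HasDerivAt G (g x) x) (hpos : ∀ x, 0 < x → 0 < g x) :
    StrictMonoOn G (Ici 0) := by
  refine strictMonoOn_of_deriv_pos (convex_Ici 0)
    (continuous_of_hasDerivAt hG).continuousOn fun x hx => ?_
  rw [(hG x).deriv]
  exact hpos x (by simpa using hx)

/-- `g < 0` on `(−∞, 0)` makes `G` strictly decreasing on `(−∞, 0]`. [folklore] -/
theorem strictAntiOn_prim (hG : ∀ x, HasDerivAt G (g x) x) (hneg : ∀ x, x < 0 → g x < 0) :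
    StrictAntiOn G (Iic 0) := by
  refine strictAntiOn_of_deriv_neg (convex_Iic 0)
    (continuous_of_hasDerivAt hG).continuousOn fun x hx => ?_
  rw [(hG x).deriv]
  exact hneg x (by simpa using hx)

/-- Convexity bound: under the hypotheses `G` is convex on `[0, ∞)`, so for `0 < q < b`,
`(G b / b) (b − q) ≤ G b − G q` (`G 0 = 0`). [folklore] -/
theorem secant_bound (hG : ∀ x, HasDerivAt G (g x) x) (hg : ∀ x, HasDerivAt g (g' x) x)
    (hg' : ∀ x, HasDerivAt g' (g'' x) x) (hpos : ∀ x, 0 < x → 0 < g x)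
    (hpos'' : ∀ x, 0 < x → 0 < g'' x) (hG0 : G 0 = 0) (hg0 : g 0 = 0) {q b : ℝ} (hq : 0 < q)
    (hqb : q < b) : G b / b * (b - q) ≤ G b - G q := by
  have hGc := continuous_of_hasDerivAt hG
  have hmono_g : MonotoneOn g (Ioi 0) := by
    intro x hx y _ hxy
    rcases hxy.eq_or_lt with rfl | hxy
    · exact le_rfl
    have hl : 1 < y / x := (one_lt_div hx).2 hxy
    have h1 := superlinear hg hg' hpos'' hg0 hl hx
    rw [div_mul_cancel₀ y hx.ne'] at h1
    have h2 := hpos x hx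
    nlinarith
  have hconv : ConvexOn ℝ (Ici 0) G := by
    refine MonotoneOn.convexOn_of_deriv (convex_Ici 0) hGc.continuousOn
      (fun x _ => (hG x).differentiableAt.differentiableWithinAt) ?_
    rw [interior_Ici, show deriv G = g from funext fun x => (hG x).deriv]
    exact hmono_g
  have h3 := hconv.secant_mono_aux3 (Set.mem_Ici.2 le_rfl) (Set.mem_Ici.2 (hq.le.trans hqb.le))
    hq hqb
  rw [hG0, sub_zero, sub_zero, le_div_iff₀ (sub_pos.2 hqb)] at h3
  exact h3

/-! ### The right half `∫₀ᵇ dq / √(2 (G b − G q))` -/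

/-- Finiteness of the half-period integral over `[0, b]`: the integrand is dominated by
`C (b − q)^{-1/2}`. [folklore] -/
theorem intervalIntegrable_right (hG : ∀ x, HasDerivAt G (g x) x)
    (hg : ∀ x, HasDerivAt g (g' x) x) (hg' : ∀ x, HasDerivAt g' (g'' x) x)
    (hpos : ∀ x, 0 < x → 0 < g x) (hpos'' : ∀ x, 0 < x → 0 < g'' x) (hG0 : G 0 = 0)
    (hg0 : g 0 = 0) {b : ℝ} (hb : 0 < b) :
    IntervalIntegrable (fun q => (√(2 * (G b - G q)))⁻¹) volume 0 b := by
  have hGc := continuous_of_hasDerivAt hG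
  have hmono := strictMonoOn_prim hG hpos
  have hE : 0 < G b := by
    have := hmono (Set.mem_Ici.2 le_rfl) (Set.mem_Ici.2 hb.le) hb
    rwa [hG0] at this
  obtain ⟨C, hC⟩ : ∃ C : ℝ, C = (√(2 * (G b / b)))⁻¹ := ⟨_, rfl⟩
  have hdom : IntervalIntegrable (fun q => C * (b - q) ^ (-(1 / 2 : ℝ))) volume 0 b := by
    have h1 : IntervalIntegrable (fun x : ℝ => x ^ (-(1 / 2 : ℝ))) volume b 0 :=
      intervalIntegral.intervalIntegrable_rpow' (by norm_num)
    have h2 := h1.comp_sub_left b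
    rw [sub_self, sub_zero] at h2
    exact h2.const_mul C
  refine hdom.mono_fun' ?_ ?_
  · have : Continuous fun q => √(2 * (G b - G q)) := by fun_prop
    exact this.measurable.inv.aestronglyMeasurable
  · rw [uIoc_of_le hb.le]
    filter_upwards [ae_restrict_mem measurableSet_Ioc] with q hq
    rcases hq.2.eq_or_lt with hqb | hqb
    · subst hqb
      simp
    · have hgap := secant_bound hG hg hg' hpos hpos'' hG0 hg0 hq.1 hqb
      have hgap0 : 0 < G b / b * (b - q) := mul_pos (div_pos hE hb) (sub_pos.2 hqb)
      rw [Real.norm_of_nonneg (inv_nonneg.2 (Real.sqrt_nonneg _))]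
      have hrhs : C * (b - q) ^ (-(1 / 2 : ℝ)) = (√(2 * (G b / b * (b - q))))⁻¹ := by
        rw [hC, Real.rpow_neg (sub_pos.2 hqb).le, ← Real.sqrt_eq_rpow, ← mul_inv,
          ← Real.sqrt_mul (show (0 : ℝ) ≤ 2 * (G b / b) by positivity), mul_assoc]
      rw [hrhs]
      exact inv_anti₀ (Real.sqrt_pos.2 (mul_pos two_pos hgap0))
        (Real.sqrt_le_sqrt (by linarith))

/-- **Comparison of the right halves.** For `0 < b₁ < b₂`:
`∫₀^{b₂} dq/√(2(G b₂ − G q)) < ∫₀^{b₁} dq/√(2(G b₁ − G q))` — substitution `q ↦ (b₂/b₁) q`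
and the pointwise inequality `scaled_gap`. [folklore] -/
theorem integral_right_lt (hG : ∀ x, HasDerivAt G (g x) x)
    (hg : ∀ x, HasDerivAt g (g' x) x) (hg' : ∀ x, HasDerivAt g' (g'' x) x)
    (hpos : ∀ x, 0 < x → 0 < g x) (hpos'' : ∀ x, 0 < x → 0 < g'' x) (hG0 : G 0 = 0)
    (hg0 : g 0 = 0) {b₁ b₂ : ℝ} (hb₁ : 0 < b₁) (hb : b₁ < b₂) :
    ∫ q in 0..b₂, (√(2 * (G b₂ - G q)))⁻¹ < ∫ q in 0..b₁, (√(2 * (G b₁ - G q)))⁻¹ := by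
  have hb₂ : 0 < b₂ := hb₁.trans hb
  have hmono := strictMonoOn_prim hG hpos
  obtain ⟨l, hl1, hlb⟩ : ∃ l : ℝ, 1 < l ∧ l * b₁ = b₂ :=
    ⟨b₂ / b₁, (one_lt_div hb₁).2 hb, div_mul_cancel₀ b₂ hb₁.ne'⟩
  have hl0 : 0 < l := one_pos.trans hl1
  have hi₁ := intervalIntegrable_right hG hg hg' hpos hpos'' hG0 hg0 hb₁
  have hi₂ : IntervalIntegrable (fun q => l * (√(2 * (G b₂ - G (l * q))))⁻¹) volume 0 b₁ := by
    have h := (intervalIntegrable_right hG hg hg' hpos hpos'' hG0 hg0 hb₂).comp_mul_left (c := l)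
    rw [zero_div, show b₂ / l = b₁ by rw [← hlb, mul_div_cancel_left₀ b₁ hl0.ne']] at h
    exact h.const_mul l
  have hsub : ∫ q in 0..b₁, l * (√(2 * (G b₂ - G (l * q))))⁻¹ =
      ∫ q in 0..b₂, (√(2 * (G b₂ - G q)))⁻¹ := by
    rw [intervalIntegral.integral_const_mul]
    have e := intervalIntegral.mul_integral_comp_mul_left
      (f := fun q => (√(2 * (G b₂ - G q)))⁻¹) (a := 0) (b := b₁) l
    rw [mul_zero, hlb] at e
    exact e
  rw [← hsub, ← sub_pos, ← intervalIntegral.integral_sub hi₁ hi₂]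
  refine intervalIntegral.intervalIntegral_pos_of_pos_on (hi₁.sub hi₂) (fun q hq => ?_) hb₁
  have hgap := scaled_gap hG hg hg' hpos'' hg0 hl1 hq.1.le hq.2
  rw [hlb] at hgap
  have hB : 0 < G b₁ - G q :=
    sub_pos.2 (hmono (Set.mem_Ici.2 hq.1.le) (Set.mem_Ici.2 hb₁.le) hq.2)
  have hA : 0 < G b₂ - G (l * q) := lt_of_le_of_lt (mul_pos (pow_pos hl0 2) hB).le hgap
  simp only [sub_pos]
  rw [← div_eq_mul_inv, ← one_div,
    div_lt_div_iff₀ (Real.sqrt_pos.2 (mul_pos two_pos hA)) (Real.sqrt_pos.2 (mul_pos two_pos hB)),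
    one_mul]
  calc l * √(2 * (G b₁ - G q)) = √(l ^ 2 * (2 * (G b₁ - G q))) := by
        rw [Real.sqrt_mul (sq_nonneg l), Real.sqrt_sq hl0.le]
    _ < √(2 * (G b₂ - G (l * q))) :=
        Real.sqrt_lt_sqrt (mul_pos (pow_pos hl0 2) (mul_pos two_pos hB)).le (by linarith)

/-! ### The left half, by the reflection `x ↦ −x` -/

/-- Chain rule with `x ↦ −x`. [folklore] -/
theorem hasDerivAt_reflect {f f' : ℝ → ℝ} (hf : ∀ x, HasDerivAt f (f' x) x) (x : ℝ) :
    HasDerivAt (fun x => f (-x)) (-f' (-x)) x := by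
  simpa [Function.comp_def] using (hf (-x)).comp x (hasDerivAt_neg' x)

/-- Chain rule with `x ↦ −x`, negated. [folklore] -/
theorem hasDerivAt_reflect_neg {f f' : ℝ → ℝ} (hf : ∀ x, HasDerivAt f (f' x) x) (x : ℝ) :
    HasDerivAt (fun x => -f (-x)) (f' (-x)) x := by
  simpa using (hasDerivAt_reflect hf x).fun_neg

/-- Finiteness of the half-period integral over `[a, 0]`, `a < 0` (reflection of
`intervalIntegrable_right`). [folklore] -/
theorem intervalIntegrable_left (hG : ∀ x, HasDerivAt G (g x) x)
    (hg : ∀ x, HasDerivAt g (g' x) x) (hg' : ∀ x, HasDerivAt g' (g'' x) x)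
    (hneg : ∀ x, x < 0 → g x < 0) (hneg'' : ∀ x, x < 0 → g'' x < 0) (hG0 : G 0 = 0)
    (hg0 : g 0 = 0) {a : ℝ} (ha : a < 0) :
    IntervalIntegrable (fun q => (√(2 * (G a - G q)))⁻¹) volume a 0 := by
  have h := intervalIntegrable_right (G := fun x => G (-x)) (g := fun x => -g (-x))
    (g' := fun x => g' (-x)) (g'' := fun x => -g'' (-x))
    (hasDerivAt_reflect hG) (hasDerivAt_reflect_neg hg) (hasDerivAt_reflect hg')
    (fun x hx => neg_pos.2 (hneg (-x) (neg_lt_zero.2 hx)))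
    (fun x hx => neg_pos.2 (hneg'' (-x) (neg_lt_zero.2 hx)))
    (by simp [hG0]) (by simp [hg0]) (neg_pos.2 ha)
  simp only [neg_neg] at h
  refine (IntervalIntegrable.iff_comp_neg (f := fun q => (√(2 * (G a - G q)))⁻¹) (a := a)
    (b := 0)).2 ?_
  rw [neg_zero]
  exact h.symm

/-- **Comparison of the left halves.** For `a₂ < a₁ < 0`:
`∫_{a₂}^0 dq/√(2(G a₂ − G q)) < ∫_{a₁}^0 dq/√(2(G a₁ − G q))` (reflection of
`integral_right_lt`). [folklore] -/
theorem integral_left_lt (hG : ∀ x, HasDerivAt G (g x) x)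
    (hg : ∀ x, HasDerivAt g (g' x) x) (hg' : ∀ x, HasDerivAt g' (g'' x) x)
    (hneg : ∀ x, x < 0 → g x < 0) (hneg'' : ∀ x, x < 0 → g'' x < 0) (hG0 : G 0 = 0)
    (hg0 : g 0 = 0) {a₁ a₂ : ℝ} (ha₁ : a₁ < 0) (ha : a₂ < a₁) :
    ∫ q in a₂..0, (√(2 * (G a₂ - G q)))⁻¹ < ∫ q in a₁..0, (√(2 * (G a₁ - G q)))⁻¹ := by
  have h := integral_right_lt (G := fun x => G (-x)) (g := fun x => -g (-x))
    (g' := fun x => g' (-x)) (g'' := fun x => -g'' (-x))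
    (hasDerivAt_reflect hG) (hasDerivAt_reflect_neg hg) (hasDerivAt_reflect hg')
    (fun x hx => neg_pos.2 (hneg (-x) (neg_lt_zero.2 hx)))
    (fun x hx => neg_pos.2 (hneg'' (-x) (neg_lt_zero.2 hx)))
    (by simp [hG0]) (by simp [hg0]) (neg_pos.2 ha₁) (neg_lt_neg ha)
  simp only [neg_neg] at h
  have e₁ := intervalIntegral.integral_comp_neg (a := 0) (b := -a₁)
    (fun q => (√(2 * (G a₁ - G q)))⁻¹)
  have e₂ := intervalIntegral.integral_comp_neg (a := 0) (b := -a₂)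
    (fun q => (√(2 * (G a₂ - G q)))⁻¹)
  simp only [neg_neg, neg_zero] at e₁ e₂
  rwa [e₁, e₂] at h

/-! ### The sublevel set `{G < E}` and the decomposition of the half-period -/

/-- For `E > 0` the sublevel set `{G < E}` is an interval `(a, b)`, `a < 0 < b`,
`G a = G b = E`. [folklore] -/
theorem sublevel (hG : ∀ x, HasDerivAt G (g x) x) (hG0 : G 0 = 0)
    (hpos : ∀ x, 0 < x → 0 < g x) (hneg : ∀ x, x < 0 → g x < 0)
    (htop : Tendsto G atTop atTop) (hbot : Tendsto G atBot atTop) {E : ℝ} (hE : 0 < E) :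
    ∃ a b, a < 0 ∧ 0 < b ∧ G a = E ∧ G b = E ∧ {q | G q < E} = Ioo a b := by
  have hGc := continuous_of_hasDerivAt hG
  have hmono := strictMonoOn_prim hG hpos
  have hanti := strictAntiOn_prim hG hneg
  obtain ⟨X, hX⟩ := Filter.tendsto_atTop_atTop.1 htop E
  obtain ⟨Y, hY⟩ := Filter.tendsto_atBot_atTop.1 hbot E
  obtain ⟨b, hb, hGb⟩ : ∃ b ∈ Icc (0 : ℝ) (max X 0), G b = E :=
    intermediate_value_Icc (le_max_right X 0) hGc.continuousOn
      ⟨by rw [hG0]; exact hE.le, hX _ (le_max_left X 0)⟩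
  obtain ⟨a, ha, hGa⟩ : ∃ a ∈ Icc (min Y 0) (0 : ℝ), G a = E :=
    intermediate_value_Icc' (min_le_right Y 0) hGc.continuousOn
      ⟨by rw [hG0]; exact hE.le, hY _ (min_le_left Y 0)⟩
  have hb0 : 0 < b := lt_of_le_of_ne hb.1 fun h => hE.ne' (by rw [← hGb, ← h, hG0])
  have ha0 : a < 0 := lt_of_le_of_ne ha.2 fun h => hE.ne' (by rw [← hGa, h, hG0])
  refine ⟨a, b, ha0, hb0, hGa, hGb, ?_⟩
  ext q
  simp only [mem_setOf_eq, mem_Ioo]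
  rcases le_or_gt 0 q with hq | hq
  · constructor
    · intro h
      exact ⟨ha0.trans_le hq, (hmono.lt_iff_lt hq hb0.le).1 (by rw [hGb]; exact h)⟩
    · rintro ⟨-, hqb⟩
      exact hGb ▸ hmono hq hb0.le hqb
  · constructor
    · intro h
      exact ⟨(hanti.lt_iff_gt hq.le ha0.le).1 (by rw [hGa]; exact h), hq.trans hb0⟩
    · rintro ⟨haq, -⟩
      exact hGa ▸ hanti ha0.le hq.le haq

/-- `T(E) = ∫ₐ⁰ + ∫₀ᵇ` over the sublevel interval `(a, b)`. [folklore] -/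
theorem integral_sublevel_eq (hG : ∀ x, HasDerivAt G (g x) x)
    (hg : ∀ x, HasDerivAt g (g' x) x) (hg' : ∀ x, HasDerivAt g' (g'' x) x)
    (hpos : ∀ x, 0 < x → 0 < g x) (hneg : ∀ x, x < 0 → g x < 0)
    (hpos'' : ∀ x, 0 < x → 0 < g'' x) (hneg'' : ∀ x, x < 0 → g'' x < 0) (hG0 : G 0 = 0)
    (hg0 : g 0 = 0) {E a b : ℝ} (ha : a < 0) (hb : 0 < b) (hGa : G a = E) (hGb : G b = E)
    (hset : {q | G q < E} = Ioo a b) :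
    ∫ q in {q | G q < E}, (√(2 * (E - G q)))⁻¹ =
      (∫ q in a..0, (√(2 * (G a - G q)))⁻¹) + ∫ q in 0..b, (√(2 * (G b - G q)))⁻¹ := by
  rw [hset, ← integral_Ioc_eq_integral_Ioo, ← intervalIntegral.integral_of_le (ha.trans hb).le,
    hGa, hGb]
  exact (intervalIntegral.integral_add_adjacent_intervals
    (hGa ▸ intervalIntegrable_left hG hg hg' hneg hneg'' hG0 hg0 ha)
    (hGb ▸ intervalIntegrable_right hG hg hg' hpos hpos'' hG0 hg0 hb)).symm

/-- **Chow–Wang 1986, Cor. 2.3 (global case), abstract form.** With `G' = g`, `g' `, `g''`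
given as functions, `G(0) = g(0) = 0`, `x g(x) > 0` and `x g''(x) > 0` for `x ≠ 0`, and
`G → +∞` at `±∞`, the half-period `E ↦ ∫_{G < E} (2(E − G))^{-1/2}` is strictly antitone on
`(0, ∞)`. [cite: ChowWang1986, Cor. 2.3] -/
theorem strictAntiOn_halfPeriod (hG : ∀ x, HasDerivAt G (g x) x)
    (hg : ∀ x, HasDerivAt g (g' x) x) (hg' : ∀ x, HasDerivAt g' (g'' x) x) (hG0 : G 0 = 0)
    (hg0 : g 0 = 0) (hpos : ∀ x, 0 < x → 0 < g x) (hneg : ∀ x, x < 0 → g x < 0)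
    (hpos'' : ∀ x, 0 < x → 0 < g'' x) (hneg'' : ∀ x, x < 0 → g'' x < 0)
    (htop : Tendsto G atTop atTop) (hbot : Tendsto G atBot atTop) :
    StrictAntiOn (fun E : ℝ => ∫ q in {q : ℝ | G q < E}, (√(2 * (E - G q)))⁻¹) (Ioi 0) := by
  intro E₁ hE₁ E₂ hE₂ hlt
  obtain ⟨a₁, b₁, ha₁, hb₁, hGa₁, hGb₁, hset₁⟩ := sublevel hG hG0 hpos hneg htop hbot hE₁
  obtain ⟨a₂, b₂, ha₂, hb₂, hGa₂, hGb₂, hset₂⟩ := sublevel hG hG0 hpos hneg htop hbot hE₂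
  have hmono := strictMonoOn_prim hG hpos
  have hanti := strictAntiOn_prim hG hneg
  have hb : b₁ < b₂ := (hmono.lt_iff_lt hb₁.le hb₂.le).1 (by rw [hGb₁, hGb₂]; exact hlt)
  have ha : a₂ < a₁ := (hanti.lt_iff_gt ha₁.le ha₂.le).1 (by rw [hGa₁, hGa₂]; exact hlt)
  simp only
  rw [integral_sublevel_eq hG hg hg' hpos hneg hpos'' hneg'' hG0 hg0 ha₁ hb₁ hGa₁ hGb₁ hset₁,
    integral_sublevel_eq hG hg hg' hpos hneg hpos'' hneg'' hG0 hg0 ha₂ hb₂ hGa₂ hGb₂ hset₂]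
  exact add_lt_add (integral_left_lt hG hg hg' hneg hneg'' hG0 hg0 ha₁ ha)
    (integral_right_lt hG hg hg' hpos hpos'' hG0 hg0 hb₁ hb)

end ChowWang1986

/-- **Chow–Wang 1986, Corollary 2.3 (global case) — discharge of the named fact
`chowWang1986_cor_2_3_global`.** For smooth `g = x^{2N+1} h` (`h > 0` smooth) with
`x g''(x) > 0` for `x ≠ 0` and `G = ∫₀ g → +∞` at `±∞`, the half-period
`E ↦ ∫_{G < E} (2(E − G(q)))^{-1/2} dq` is strictly decreasing on `(0, ∞)`.
Proof: `ChowWang1986.strictAntiOn_halfPeriod` (elementary comparison after the scaling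
substitution `q ↦ (b₂/b₁) q`; see the module docstring for the relation to the printed proof
via Thm. 2.1). [cite: ChowWang1986, Cor. 2.3 (with (H1), §2, pp. 15–18)] -/
theorem chowWang1986_cor_2_3_global_holds : chowWang1986_cor_2_3_global := by
  intro g hg_smooth hfact hconv htop hbot
  obtain ⟨N, h, -, hpos_h, hgh⟩ := hfact
  obtain ⟨hgd, hg'smooth⟩ := contDiff_infty_iff_deriv.1 hg_smooth
  have hg'd : Differentiable ℝ (deriv g) := (contDiff_infty_iff_deriv.1 hg'smooth).1
  have hgc : Continuous g := hgd.continuous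
  refine ChowWang1986.strictAntiOn_halfPeriod (G := fun x => ∫ y in (0 : ℝ)..x, g y)
    (g' := deriv g) (g'' := deriv (deriv g))
    (fun x => (hgc.integral_hasStrictDerivAt 0 x).hasDerivAt) (fun x => (hgd x).hasDerivAt)
    (fun x => (hg'd x).hasDerivAt) intervalIntegral.integral_same ?_ ?_ ?_ ?_ ?_ htop hbot
  · rw [hgh]; simp
  · intro x hx
    rw [hgh]
    exact mul_pos (pow_pos hx _) (hpos_h x)
  · intro x hx
    rw [hgh]
    exact mul_neg_of_neg_of_pos ((odd_two_mul_add_one N).pow_neg hx) (hpos_h x)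
  · intro x hx
    have := hconv x hx.ne'
    nlinarith
  · intro x hx
    have := hconv x hx.ne
    nlinarith

end Literature.Analysis.ODE
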